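import Mathlib
import Summits.Ventures.PercRepro2.Defs
import Summits.Ventures.PercRepro2.Independence
import Summits.Ventures.PercRepro2.Harris
import Summits.Ventures.PercRepro2.Graph
import Summits.Ventures.PercRepro2.Exploration
import Summits.Ventures.PercRepro2.Events
import Summits.Ventures.PercRepro2.Statements
import Summits.Ventures.PercRepro2.FourFunctions
import Summits.Ventures.PercRepro2.Induced
import Summits.Ventures.PercRepro2.Frontier
import Summits.Ventures.PercRepro2.ObsIndependence
import Summits.Ventures.PercRepro2.BHK
import Summits.Ventures.PercRepro2.BHKEvents
import Summits.Ventures.PercRepro2.OrderPreservation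

/-!
# The `|A| = 2` coefficient inequality (blind cell PercRepro2, p1; T2 target R6-core)

`R6Core p ends v a₁ a₂ 𝓔` (Statements.lean; proofs/LEAD-PROOFSHAPES.md §2): with
`D = {a₁ ↮ a₂}`, `h_j = P(v ↔ a_j, D)`, `X_j = P(C(a_j) ∈ 𝓔, v ↔ a_j, D)` and
`Y_j = P(C(a_{3−j}) ∈ 𝓔, v ↔ a_j, D)`,

  `h₂ · (X₁ − Y₁) + h₁ · (X₂ − Y₂) ≥ 0`.

Proof: four BHK inequalities (Kozma–Nitzan's "applying BHK 4 times", arXiv:2401.12397, proof of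
Theorem 1, with the cluster property `1{C(·) ∈ 𝓔}` in place of `1{· ↔ b}`):
the same-cluster inequality `bhk_same_cluster_events` gives `X_j · P(D) ≥ P(C(a_j) ∈ 𝓔, D) · h_j`,
the cross-cluster inequality `bhk_cross_cluster` gives `Y_j · P(D) ≤ P(C(a_{3−j}) ∈ 𝓔, D) · h_j`;
multiplying by `h_{3−j}` and adding, the right-hand sides cancel.
-/

namespace Summit.Ventures.PercRepro2

section KNTwo

variable {V : Type*} {E : Type*} [Fintype E] [DecidableEq E] [Fintype V] [DecidableEq V]
  {R : Type*} [Field R] [LinearOrder R] [IsStrictOrderedRing R]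

omit [Fintype E] [DecidableEq E] [Fintype V] [DecidableEq V] in
/-- `{v ∈ C(x)} = {v ↔ x}`. -/
lemma clusterInEvent_mem_eq_connEvent (ends : E → Sym2 V) (x v : V) :
    clusterInEvent ends x {W | v ∈ W} = connEvent ends v x := by
  ext ω
  simp only [mem_clusterInEvent, Set.mem_setOf_eq, mem_cluster, mem_connEvent]
  exact ⟨conn_symm, conn_symm⟩

/-- **R6-core** for every admissible weight vector, up-set `𝓔` and vertices `v, a₁, a₂`
(no distinctness needed). -/
theorem r6Core (p : E → R) (hp : IsProbVec p) (ends : E → Sym2 V) (v a₁ a₂ : V)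
    {𝓔 : Set (Set V)} (h𝓔 : IsUpperSet 𝓔) : R6Core p ends v a₁ a₂ 𝓔 := by
  unfold R6Core
  set D := (connEvent ends a₁ a₂)ᶜ with hD
  have hD' : (connEvent ends a₂ a₁)ᶜ = D := by rw [hD, connEvent_comm]
  have hv : IsUpperSet {W : Set V | v ∈ W} := fun _ _ h hv => h hv
  -- the four BHK inequalities
  have a1 := bhk_same_cluster_events p hp ends a₁ a₂ h𝓔 hv
  have a2 := bhk_same_cluster_events p hp ends a₂ a₁ h𝓔 hv
  have b1 := bhk_cross_cluster p hp ends a₂ a₁ h𝓔 hv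
  have b2 := bhk_cross_cluster p hp ends a₁ a₂ h𝓔 hv
  rw [clusterInEvent_mem_eq_connEvent] at a1 a2 b1 b2
  rw [hD'] at a2 b1
  -- names
  set d := prob p D
  set h₁ := prob p (connEvent ends v a₁ ∩ D)
  set h₂ := prob p (connEvent ends v a₂ ∩ D)
  set X₁ := prob p (clusterInEvent ends a₁ 𝓔 ∩ connEvent ends v a₁ ∩ D)
  set X₂ := prob p (clusterInEvent ends a₂ 𝓔 ∩ connEvent ends v a₂ ∩ D)
  set Y₁ := prob p (clusterInEvent ends a₂ 𝓔 ∩ connEvent ends v a₁ ∩ D)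
  set Y₂ := prob p (clusterInEvent ends a₁ 𝓔 ∩ connEvent ends v a₂ ∩ D)
  set P₁ := prob p (clusterInEvent ends a₁ 𝓔 ∩ D)
  set P₂ := prob p (clusterInEvent ends a₂ 𝓔 ∩ D)
  have hh₁ : 0 ≤ h₁ := prob_nonneg hp _
  have hh₂ : 0 ≤ h₂ := prob_nonneg hp _
  have hd : 0 ≤ d := prob_nonneg hp _
  have h₁d : h₁ ≤ d := prob_mono hp Set.inter_subset_right
  have h₂d : h₂ ≤ d := prob_mono hp Set.inter_subset_right
  -- `a1 : P₁ * h₁ ≤ X₁ * d`, `b1 : Y₁ * d ≤ P₂ * h₁`, `a2 : P₂ * h₂ ≤ X₂ * d`, `b2 : Y₂ * d ≤ P₁ * h₂`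
  have e1 := mul_le_mul_of_nonneg_left a1 hh₂
  have e2 := mul_le_mul_of_nonneg_left b1 hh₂
  have e3 := mul_le_mul_of_nonneg_left a2 hh₁
  have e4 := mul_le_mul_of_nonneg_left b2 hh₁
  have key : 0 ≤ (h₂ * (X₁ - Y₁) + h₁ * (X₂ - Y₂)) * d := by linarith
  rcases hd.lt_or_eq with hd0 | hd0
  · have h0 : 0 * d ≤ (h₂ * (X₁ - Y₁) + h₁ * (X₂ - Y₂)) * d := by rw [zero_mul]; exact key
    exact le_of_mul_le_mul_right h0 hd0
  · have h₁0 : h₁ = 0 := le_antisymm (hd0 ▸ h₁d) hh₁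
    have h₂0 : h₂ = 0 := le_antisymm (hd0 ▸ h₂d) hh₂
    rw [h₁0, h₂0]
    ring_nf
    exact le_refl 0

end KNTwo

section Closure

variable (R : Type) [Field R] [LinearOrder R] [IsStrictOrderedRing R]

/-- **T2 target #1**: `R6Core_all R` — R6-core for every finite graph. -/
theorem r6Core_all : R6Core_all R := by
  intro V E _ _ _ _ ends p hp v a₁ a₂ _ _ _ 𝓔 h𝓔
  exact r6Core p hp ends v a₁ a₂ h𝓔

end Closure


/-! ## Corollary (i): the first-hit coefficient form at `|A| = 2` for indicator cluster properties -/

section CorollaryOne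

variable {V : Type*} {E : Type*} [Fintype E] [DecidableEq E] [Fintype V] [DecidableEq V]
  {R : Type*} [Field R] [LinearOrder R] [IsStrictOrderedRing R]

omit [Fintype V] [DecidableEq V] [LinearOrder R] [IsStrictOrderedRing R] in
/-- Three-way split of `P(X ∩ (C₁ ∪ C₂))`. -/
lemma prob_inter_union_eq_three (p : E → R) (X C₁ C₂ : Set (Config E)) :
    prob p (X ∩ (C₁ ∪ C₂)) =
      prob p (X ∩ C₁ ∩ C₂) + prob p (X ∩ C₁ ∩ C₂ᶜ) + prob p (X ∩ C₂ ∩ C₁ᶜ) := by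
  have h1 := prob_union_add_prob_inter p (X ∩ C₁) (X ∩ C₂)
  have h2 := prob_inter_add_prob_inter_compl p (X ∩ C₁) C₂
  have h3 := prob_inter_add_prob_inter_compl p (X ∩ C₂) C₁
  have e1 : X ∩ C₁ ∪ X ∩ C₂ = X ∩ (C₁ ∪ C₂) := (Set.inter_union_distrib_left X C₁ C₂).symm
  have e2 : X ∩ C₁ ∩ (X ∩ C₂) = X ∩ C₁ ∩ C₂ := by
    ext ω; simp only [Set.mem_inter_iff]; tauto
  have e3 : X ∩ C₂ ∩ C₁ = X ∩ C₁ ∩ C₂ := by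
    ext ω; simp only [Set.mem_inter_iff]; tauto
  rw [e1, e2] at h1
  rw [e3] at h3
  linear_combination h1 - h2 - h3

omit [Fintype E] [DecidableEq E] [Fintype V] in
/-- `{v ↔ {a₁, a₂}} = {v ↔ a₁} ∪ {v ↔ a₂}`. -/
lemma hitEvent_pair (ends : E → Sym2 V) (v a₁ a₂ : V) :
    hitEvent ends v {a₁, a₂} = connEvent ends v a₁ ∪ connEvent ends v a₂ := by
  ext ω
  simp [hitEvent]

omit [Fintype V] [DecidableEq V] [LinearOrder R] [IsStrictOrderedRing R] in
/-- `E(1{C(x) ∈ 𝓔} · 1{v ↔ A}) = P(C(x) ∈ 𝓔, v ↔ A)`. -/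
lemma hitExpect_clusterIndicator (p : E → R) (ends : E → Sym2 V) (A : Finset V) (v : V)
    (𝓔 : Set (Set V)) (x : V) :
    hitExpect p ends A v (clusterIndicator ends 𝓔) x =
      prob p (clusterInEvent ends x 𝓔 ∩ hitEvent ends v A) := by
  unfold hitExpect clusterIndicator
  rw [prob_eq_expect_indicator]
  unfold expect
  exact Finset.sum_congr rfl fun ω _ => by rw [indicator_inter_one]

omit [Fintype E] [DecidableEq E] [Fintype V] [DecidableEq V] in
/-- On `{v ↔ x}` the cluster events of `x` and `v` coincide (with the connection in front). -/
lemma clusterInEvent_inter_connEvent_inter_eq (ends : E → Sym2 V) (v x : V) (𝓔 : Set (Set V))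
    (A : Set (Config E)) :
    clusterInEvent ends x 𝓔 ∩ connEvent ends v x ∩ A =
      clusterInEvent ends v 𝓔 ∩ connEvent ends v x ∩ A := by
  ext ω
  simp only [Set.mem_inter_iff, mem_clusterInEvent, mem_connEvent]
  constructor
  · rintro ⟨⟨h1, h2⟩, h3⟩
    exact ⟨⟨by rwa [cluster_eq_of_conn h2], h2⟩, h3⟩
  · rintro ⟨⟨h1, h2⟩, h3⟩
    exact ⟨⟨by rwa [← cluster_eq_of_conn h2], h2⟩, h3⟩

/-- **Corollary (i)**: R6 at `A = {a₁, a₂}` for the cluster property `1{C(·) ∈ 𝓔}`. -/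
theorem r6Indicator_pair (p : E → R) (hp : IsProbVec p) (ends : E → Sym2 V) (v : V) {a₁ a₂ : V}
    (hne : a₁ ≠ a₂) {𝓔 : Set (Set V)} (h𝓔 : IsUpperSet 𝓔) :
    R6FirstHitCoefficient p ends {a₁, a₂} v (clusterIndicator ends 𝓔) := by
  intro hpos
  have core := r6Core p hp ends v a₁ a₂ h𝓔
  unfold R6Core at core
  simp only [Finset.sum_pair hne] at hpos ⊢
  rw [firstHitWeight_pair_left p ends hne v, firstHitWeight_pair_right p ends hne v] at hpos ⊢
  simp only [hitExpect_clusterIndicator, hitEvent_pair, prob_inter_union_eq_three]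
  -- the three regions
  set C₁ := connEvent ends v a₁
  set C₂ := connEvent ends v a₂
  set D := (connEvent ends a₁ a₂)ᶜ
  have r1 : C₁ ∩ C₂ᶜ = C₁ ∩ D := connEvent_inter_compl_connEvent_eq ends v a₁ a₂
  have r2 : C₂ ∩ C₁ᶜ = C₂ ∩ D := by
    have := connEvent_inter_compl_connEvent_eq ends v a₂ a₁
    rwa [connEvent_comm ends a₂ a₁] at this
  -- on `C₁ ∩ C₂` all three clusters agree; on `C₁ ∩ D` the clusters of `v`, `a₁` agree, etc.
  have cv1 : ∀ A : Set (Config E), clusterInEvent ends a₁ 𝓔 ∩ C₁ ∩ A =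
      clusterInEvent ends v 𝓔 ∩ C₁ ∩ A := fun A => clusterInEvent_inter_connEvent_inter_eq ends v a₁ 𝓔 A
  have cv2 : ∀ A : Set (Config E), clusterInEvent ends a₂ 𝓔 ∩ C₂ ∩ A =
      clusterInEvent ends v 𝓔 ∩ C₂ ∩ A := fun A => clusterInEvent_inter_connEvent_inter_eq ends v a₂ 𝓔 A
  have cv2' : clusterInEvent ends a₂ 𝓔 ∩ C₁ ∩ C₂ = clusterInEvent ends v 𝓔 ∩ C₁ ∩ C₂ := by
    rw [Set.inter_assoc, Set.inter_comm C₁ C₂, ← Set.inter_assoc, cv2, Set.inter_assoc,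
      Set.inter_comm C₂ C₁, ← Set.inter_assoc]
  have cv1' : clusterInEvent ends a₁ 𝓔 ∩ C₂ ∩ C₁ = clusterInEvent ends v 𝓔 ∩ C₂ ∩ C₁ := by
    rw [Set.inter_assoc, Set.inter_comm C₂ C₁, ← Set.inter_assoc, cv1, Set.inter_assoc,
      Set.inter_comm C₁ C₂, ← Set.inter_assoc]
  -- rewrite the regions
  have e0 : ∀ X : Set (Config E), X ∩ C₁ ∩ C₂ᶜ = X ∩ (C₁ ∩ D) := fun X => by
    rw [Set.inter_assoc, r1]
  have e0' : ∀ X : Set (Config E), X ∩ C₂ ∩ C₁ᶜ = X ∩ (C₂ ∩ D) := fun X => by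
    rw [Set.inter_assoc, r2]
  simp only [e0, e0', ← Set.inter_assoc]
  rw [cv1 C₂, cv2', cv1 D, cv2 D]
  rw [cv1 D, cv2 D] at core
  -- the algebra
  set c := prob p (clusterInEvent ends v 𝓔 ∩ C₁ ∩ C₂)
  set X₁ := prob p (clusterInEvent ends v 𝓔 ∩ C₁ ∩ D)
  set X₂ := prob p (clusterInEvent ends v 𝓔 ∩ C₂ ∩ D)
  set Y₁ := prob p (clusterInEvent ends a₂ 𝓔 ∩ C₁ ∩ D)
  set Y₂ := prob p (clusterInEvent ends a₁ 𝓔 ∩ C₂ ∩ D)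
  set h₁ := prob p (C₁ ∩ D)
  set h₂ := prob p (C₂ ∩ D)
  rw [div_mul_eq_mul_div, div_mul_eq_mul_div, ← add_div, div_le_iff₀ hpos]
  nlinarith [core]

end CorollaryOne

/-! ## Corollaries (ii) and (iii): Kozma–Nitzan Theorems 7 (indicator case) and 1 -/

section CorollaryTwo

variable {V : Type*} {E : Type*} [Fintype E] [DecidableEq E] [Fintype V] [DecidableEq V]
  {R : Type*} [Field R] [LinearOrder R] [IsStrictOrderedRing R]

omit [Fintype V] [LinearOrder R] [IsStrictOrderedRing R] in
/-- The three-region form of `E(1{C(x) ∈ 𝓔} · 1{v ↔ {a₁, a₂}})`. -/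
lemma hitExpect_clusterIndicator_pair (p : E → R) (ends : E → Sym2 V) (v a₁ a₂ x : V)
    (𝓔 : Set (Set V)) :
    hitExpect p ends {a₁, a₂} v (clusterIndicator ends 𝓔) x =
      prob p (clusterInEvent ends x 𝓔 ∩ connEvent ends v a₁ ∩ connEvent ends v a₂) +
      prob p (clusterInEvent ends x 𝓔 ∩ connEvent ends v a₁ ∩ (connEvent ends a₁ a₂)ᶜ) +
      prob p (clusterInEvent ends x 𝓔 ∩ connEvent ends v a₂ ∩ (connEvent ends a₁ a₂)ᶜ) := by
  have r1 : clusterInEvent ends x 𝓔 ∩ connEvent ends v a₁ ∩ (connEvent ends v a₂)ᶜ =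
      clusterInEvent ends x 𝓔 ∩ connEvent ends v a₁ ∩ (connEvent ends a₁ a₂)ᶜ := by
    rw [Set.inter_assoc, connEvent_inter_compl_connEvent_eq, ← Set.inter_assoc]
  have r2 : clusterInEvent ends x 𝓔 ∩ connEvent ends v a₂ ∩ (connEvent ends v a₁)ᶜ =
      clusterInEvent ends x 𝓔 ∩ connEvent ends v a₂ ∩ (connEvent ends a₁ a₂)ᶜ := by
    rw [Set.inter_assoc, connEvent_inter_compl_connEvent_eq ends v a₂ a₁, connEvent_comm ends a₂ a₁,
      ← Set.inter_assoc]
  rw [hitExpect_clusterIndicator, hitEvent_pair, prob_inter_union_eq_three, r1, r2]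

/-- **Corollary (ii), indicator case — Kozma–Nitzan Theorem 7** for the cluster properties
`1{C(·) ∈ 𝓔}`: `min_{a ∈ {a₁,a₂}} E(f(a); v ↔ A) ≤ E(f(v); v ↔ A)`. -/
theorem knTheorem7_indicator (p : E → R) (hp : IsProbVec p) (ends : E → Sym2 V) (v : V)
    {a₁ a₂ : V} (hne : a₁ ≠ a₂) {𝓔 : Set (Set V)} (h𝓔 : IsUpperSet 𝓔) :
    KNConjecture4 p ends {a₁, a₂} (Finset.insert_nonempty a₁ {a₂}) v (clusterIndicator ends 𝓔) := by
  by_cases hpos : 0 < ∑ a ∈ ({a₁, a₂} : Finset V), firstHitWeight p ends v {a₁, a₂} a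
  · exact KNConjecture4_of_R6FirstHitCoefficient hp _ hpos (r6Indicator_pair p hp ends v hne h𝓔)
  -- degenerate case: both first-hit weights vanish, all three expectations coincide
  rw [Finset.sum_pair hne, firstHitWeight_pair_left p ends hne v,
    firstHitWeight_pair_right p ends hne v] at hpos
  have hh₁ : 0 ≤ prob p (connEvent ends v a₁ ∩ (connEvent ends a₁ a₂)ᶜ) := prob_nonneg hp _
  have hh₂ : 0 ≤ prob p (connEvent ends v a₂ ∩ (connEvent ends a₁ a₂)ᶜ) := prob_nonneg hp _
  have h₁0 : prob p (connEvent ends v a₁ ∩ (connEvent ends a₁ a₂)ᶜ) = 0 := by linarith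
  have h₂0 : prob p (connEvent ends v a₂ ∩ (connEvent ends a₁ a₂)ᶜ) = 0 := by linarith
  have vanish : ∀ (x : V) (C : Set (Config E)),
      prob p (C ∩ (connEvent ends a₁ a₂)ᶜ) = 0 →
      prob p (clusterInEvent ends x 𝓔 ∩ C ∩ (connEvent ends a₁ a₂)ᶜ) = 0 := by
    intro x C hC
    refine le_antisymm ?_ (prob_nonneg hp _)
    rw [← hC]
    exact prob_mono hp (Set.inter_subset_inter_left _ Set.inter_subset_right)
  have eq : ∀ x : V, hitExpect p ends {a₁, a₂} v (clusterIndicator ends 𝓔) x =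
      prob p (clusterInEvent ends x 𝓔 ∩ connEvent ends v a₁ ∩ connEvent ends v a₂) := by
    intro x
    rw [hitExpect_clusterIndicator_pair, vanish x _ h₁0, vanish x _ h₂0, add_zero, add_zero]
  have ev : hitExpect p ends {a₁, a₂} v (clusterIndicator ends 𝓔) a₁ =
      hitExpect p ends {a₁, a₂} v (clusterIndicator ends 𝓔) v := by
    rw [eq, eq, clusterInEvent_inter_connEvent_inter_eq]
  unfold KNConjecture4
  rw [← ev]
  exact Finset.inf'_le _ (Finset.mem_insert_self a₁ {a₂})

omit [Fintype E] [DecidableEq E] [Fintype V] [DecidableEq V] [LinearOrder R]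
  [IsStrictOrderedRing R] in
/-- `1{· ↔ b}` is the indicator cluster property of the up-set `{W | b ∈ W}`. -/
lemma connIndicator_eq_clusterIndicator (ends : E → Sym2 V) (b : V) :
    connIndicator (R := R) ends b = clusterIndicator ends {W | b ∈ W} := by
  funext x ω
  simp only [connIndicator, clusterIndicator, connEvent_eq_clusterInEvent]

/-- **Corollary (iii) — Kozma–Nitzan Theorem 1**: the pre-FKG inequality (3) at `A = {a₁, a₂}`. -/
theorem knTheorem1_pair (p : E → R) (hp : IsProbVec p) (ends : E → Sym2 V) (v b : V)
    {a₁ a₂ : V} (hne : a₁ ≠ a₂) :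
    PreFKG p ends {a₁, a₂} (Finset.insert_nonempty a₁ {a₂}) v b := by
  refine PreFKG_of_KNConjecture4 ?_
  rw [connIndicator_eq_clusterIndicator]
  exact knTheorem7_indicator p hp ends v hne (isUpperSet_mem_setOf b)

end CorollaryTwo

section ClosuresTwo

variable (R : Type) [Field R] [LinearOrder R] [IsStrictOrderedRing R]

/-- Corollary (i) for every finite graph: `R6Indicator_card_two R`. -/
theorem r6Indicator_card_two : R6Indicator_card_two R := by
  intro V E _ _ _ _ ends p hp v a₁ a₂ hne 𝓔 h𝓔
  exact r6Indicator_pair p hp ends v hne h𝓔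

/-- **Kozma–Nitzan Theorem 1 for every finite graph** (the case `a₁ = a₂` is the trivial one):
`KNTheorem1 R`. -/
theorem knTheorem1 : KNTheorem1 R := by
  intro V E _ _ _ _ ends p hp v b a₁ a₂
  by_cases hne : a₁ = a₂
  · subst hne
    unfold PreFKG
    have : ({a₁, a₁} : Finset V) = {a₁} := by simp
    simp only [this, Finset.inf'_singleton]
    have e : connEvent ends a₁ b ∩ hitEvent ends v {a₁} =
        connEvent ends v b ∩ hitEvent ends v {a₁} := by
      ext ω
      simp only [Set.mem_inter_iff, mem_connEvent, mem_hitEvent, Finset.mem_singleton,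
        exists_eq_left]
      constructor
      · rintro ⟨h1, h2⟩
        exact ⟨conn_trans h2 h1, h2⟩
      · rintro ⟨h1, h2⟩
        exact ⟨conn_trans (conn_symm h2) h1, h2⟩
    rw [Set.inter_comm, e]
  · exact knTheorem1_pair p hp ends v b hne

end ClosuresTwo

end Summit.Ventures.PercRepro2
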